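import Literature.NumberTheory.LFunctions.SinnottRationalMeasure
import Literature.NumberTheory.LFunctions.SinnottMonomialIndependence
import Mathlib.LinearAlgebra.Basis.VectorSpace
import Mathlib.Data.Finsupp.Lex
import Mathlib.RingTheory.HahnSeries.Summable
import Mathlib.FieldTheory.RatFunc.AsPolynomial
import Mathlib.RingTheory.Algebraic.Basic
import Mathlib.SetTheory.Cardinal.Order
import HarnessLib

/-!
# Sinnott's Theorem 3.2: non-vanishing of `Γ`-transforms of rational function measures

Topic `Literature/NumberTheory/LFunctions`; namespace `Literature.NumberTheory.LFunctions.Sinnott1987`.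
THEOREMS ONLY (auxiliary `def`s with bodies; no named facts).

We finish the proof of Theorem 3.2 of W. Sinnott, *On a theorem of L. Washington*, Astérisque
147–148 (1987): with `F ⊆ 𝔽_q ⊆ E`, `M ≠ p = char E`, `φ = f/g` with `r = f/g ∈ F(Z)`
satisfying `∑_{εᴹ=1} r(εZ) = 0` (the measure is supported on `ℤ_Mˣ`, (1.17)–(1.18)) and
`r(Z) + r(Z⁻¹) ≠ 0`, the `Γ`-transforms `Γ_α(ψ)` are nonzero for all characters `ψ` of
`(ℤ/M^m)ˣ` with kernel `V` once `m` is large (`sinnott_gammaTransform_ne_zero`), and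
consequently `∑_{c ∈ (ℤ/M^m)ˣ} ψ(c) φ(ζ^c) ≠ 0` (`sinnott_sum_psi_ratFn_ne_zero`).

The remaining step (given the file `SinnottRationalMeasure`) is: some `P_y ≠ 0`.  If all
`P_y = 0`, the embedding `F[ℤ_M] ↪ F⟦Γ⟧` into a Hahn-series field (`Γ = Lex(B →₀ ℚ)` for a
`ℚ`-basis `B` of `ℚ_M`; Sinnott's Corollary 2.4) turns `P_y = 0` into
`∑_{θ ∈ V₊} Φ_θ(u_{θ,y}) = 0` with `u_{θ,y} = R_{θ,y}(Z) + R_{-θ,y}(Z⁻¹)`, and the Appendix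
(file `SinnottMonomialIndependence`) makes every `u_{θ,y}` constant; summing over `θ` and `y`
gives `r(Z) + r(Z⁻¹) ∈ F`, and the support condition forces `r(Z) + r(Z⁻¹) = 0`.

## References

* W. Sinnott, *On a theorem of L. Washington*, Astérisque 147–148 (1987), 209–224, §3 and Appendix.
  [Sinnott1987]
* W. Sinnott, *On the `μ`-invariant of the `Γ`-transform of a rational function*, Invent. Math.
  75 (1984), 273–282, Proposition 3.1. [Sinnott1984]
-/

noncomputable section

open Finset Polynomial

namespace Literature.NumberTheory.LFunctions.Sinnott1987

/-! ### Algebra endomorphisms `Z ↦ Z⁻¹` and `Z ↦ cZ` of `F(Z)` -/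

section RatFuncAlgebra

variable {F : Type*} [Field F]

/-- `Z⁻¹` is transcendental over `F`. [folklore] -/
theorem transcendental_X_inv : Transcendental F ((RatFunc.X : RatFunc F)⁻¹) :=
  fun h ↦ RatFunc.transcendental_X (IsAlgebraic.inv_iff.mp h)

/-- `cZ` is transcendental over `F` for a unit `c`. [folklore] -/
theorem transcendental_C_mul_X (c : Fˣ) :
    Transcendental F (RatFunc.C (c : F) * RatFunc.X : RatFunc F) := by
  have h := (RatFunc.transcendental_X (K := F)).aeval (Polynomial.C (c : F) * Polynomial.X)
    (by rw [natDegree_C_mul_X _ c.ne_zero]; exact one_ne_zero)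
    (by rw [leadingCoeff_C_mul_X]; exact mem_nonZeroDivisors_of_ne_zero c.ne_zero)
  simpa [RatFunc.algebraMap_eq_C] using h

/-- **`ι : r(Z) ↦ r(Z⁻¹)`**, an `F`-algebra endomorphism of `F(Z)`. [cite: Sinnott1987, (3.13)–(3.14)] -/
def invX : RatFunc F →ₐ[F] RatFunc F :=
  RatFunc.liftAlgHom (Polynomial.aeval ((RatFunc.X : RatFunc F)⁻¹))
    (nonZeroDivisors_le_comap_nonZeroDivisors_of_injective _
      (transcendental_iff_injective.mp transcendental_X_inv))

/-- **`σ_c : r(Z) ↦ r(cZ)`** for a unit `c`, an `F`-algebra endomorphism of `F(Z)`.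
[cite: Sinnott1987, (1.18)] -/
def scaleX (c : Fˣ) : RatFunc F →ₐ[F] RatFunc F :=
  RatFunc.liftAlgHom (Polynomial.aeval (RatFunc.C (c : F) * RatFunc.X : RatFunc F))
    (nonZeroDivisors_le_comap_nonZeroDivisors_of_injective _
      (transcendental_iff_injective.mp (transcendental_C_mul_X c)))

/-- `ι` on polynomials. [folklore] -/
theorem invX_algebraMap (P : F[X]) :
    invX (algebraMap F[X] (RatFunc F) P) = Polynomial.aeval ((RatFunc.X : RatFunc F)⁻¹) P := by
  have := RatFunc.liftAlgHom_apply_div (Polynomial.aeval ((RatFunc.X : RatFunc F)⁻¹))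
    (nonZeroDivisors_le_comap_nonZeroDivisors_of_injective _
      (transcendental_iff_injective.mp transcendental_X_inv)) P 1
  rwa [map_one, div_one, map_one, div_one] at this

/-- `σ_c` on polynomials. [folklore] -/
theorem scaleX_algebraMap (c : Fˣ) (P : F[X]) :
    scaleX c (algebraMap F[X] (RatFunc F) P) =
      Polynomial.aeval (RatFunc.C (c : F) * RatFunc.X : RatFunc F) P := by
  have := RatFunc.liftAlgHom_apply_div (Polynomial.aeval (RatFunc.C (c : F) * RatFunc.X : RatFunc F))
    (nonZeroDivisors_le_comap_nonZeroDivisors_of_injective _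
      (transcendental_iff_injective.mp (transcendental_C_mul_X c))) P 1
  rwa [map_one, div_one, map_one, div_one] at this

/-- `ι(Z) = Z⁻¹`. [folklore] -/
theorem invX_X : invX (RatFunc.X : RatFunc F) = RatFunc.X⁻¹ := by
  rw [← RatFunc.algebraMap_X, invX_algebraMap, aeval_X, RatFunc.algebraMap_X]

/-- `σ_c(Z) = cZ`. [folklore] -/
theorem scaleX_X (c : Fˣ) : scaleX c (RatFunc.X : RatFunc F) = RatFunc.C (c : F) * RatFunc.X := by
  rw [← RatFunc.algebraMap_X, scaleX_algebraMap, aeval_X, RatFunc.algebraMap_X]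

/-- `F`-algebra homs out of `F(Z)` into a field agree if they agree on `Z`. [folklore] -/
theorem ratFunc_algHom_ext {A : Type*} [Field A] [Algebra F A] (σ τ : RatFunc F →ₐ[F] A)
    (h : σ RatFunc.X = τ RatFunc.X) : σ = τ := by
  have hpoly : ∀ P : F[X], σ (algebraMap F[X] (RatFunc F) P) = τ (algebraMap F[X] (RatFunc F) P) := by
    intro P
    have hP : algebraMap F[X] (RatFunc F) P = Polynomial.aeval (RatFunc.X : RatFunc F) P := by
      rw [← RatFunc.algebraMap_X, Polynomial.aeval_algebraMap_apply, Polynomial.aeval_X_left_apply]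
    rw [hP, ← Polynomial.aeval_algHom_apply, ← Polynomial.aeval_algHom_apply, h]
  refine AlgHom.ext fun x ↦ ?_
  refine RatFunc.induction_on (P := fun x ↦ σ x = τ x) x fun f g _ ↦ ?_
  rw [map_div₀, map_div₀, hpoly, hpoly]

/-- `F`-algebra endomorphisms of `F(Z)` fix constants. [folklore] -/
theorem algHom_C (σ : RatFunc F →ₐ[F] RatFunc F) (c : F) : σ (RatFunc.C c) = RatFunc.C c := by
  rw [← RatFunc.algebraMap_eq_C]; exact σ.commutes c

/-- `ι ∘ ι = id`. [folklore] -/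
theorem invX_invX (x : RatFunc F) : invX (invX x) = x := by
  have : (invX.comp invX : RatFunc F →ₐ[F] RatFunc F) = AlgHom.id F (RatFunc F) := by
    refine ratFunc_algHom_ext _ _ ?_
    rw [AlgHom.comp_apply, invX_X, map_inv₀, invX_X, inv_inv, AlgHom.id_apply]
  exact congrArg (fun φ : RatFunc F →ₐ[F] RatFunc F ↦ φ x) this

/-- `σ_1 = id`. [folklore] -/
theorem scaleX_one (x : RatFunc F) : scaleX 1 x = x := by
  have : (scaleX 1 : RatFunc F →ₐ[F] RatFunc F) = AlgHom.id F (RatFunc F) := by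
    refine ratFunc_algHom_ext _ _ ?_
    rw [scaleX_X, Units.val_one, map_one, one_mul, AlgHom.id_apply]
  exact congrArg (fun φ : RatFunc F →ₐ[F] RatFunc F ↦ φ x) this

/-- `σ_c ∘ ι = ι ∘ σ_{c⁻¹}`. [folklore] -/
theorem scaleX_invX (c : Fˣ) (x : RatFunc F) : scaleX c (invX x) = invX (scaleX c⁻¹ x) := by
  have : ((scaleX c).comp invX : RatFunc F →ₐ[F] RatFunc F) = invX.comp (scaleX c⁻¹) := by
    refine ratFunc_algHom_ext _ _ ?_
    rw [AlgHom.comp_apply, AlgHom.comp_apply, invX_X, map_inv₀, scaleX_X, scaleX_X, map_mul,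
      invX_X, algHom_C, Units.val_inv_eq_inv_val, map_inv₀, mul_inv]
  exact congrArg (fun φ : RatFunc F →ₐ[F] RatFunc F ↦ φ x) this

/-- `σ_c (f/g) = f(cZ)/g(cZ)`. [folklore] -/
theorem scaleX_div (c : Fˣ) (f g : F[X]) :
    scaleX c (algebraMap F[X] (RatFunc F) f / algebraMap F[X] (RatFunc F) g) =
      algebraMap F[X] (RatFunc F) (f.comp (C (c : F) * X)) /
        algebraMap F[X] (RatFunc F) (g.comp (C (c : F) * X)) := by
  have hcomp : ∀ P : F[X], scaleX c (algebraMap F[X] (RatFunc F) P) =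
      algebraMap F[X] (RatFunc F) (P.comp (C (c : F) * X)) := by
    intro P
    rw [scaleX_algebraMap, comp_eq_aeval, ← Polynomial.aeval_algebraMap_apply, map_mul,
      RatFunc.algebraMap_C, RatFunc.algebraMap_X]
  rw [map_div₀, hcomp, hcomp]

end RatFuncAlgebra

/-! ### The Hahn-series field `F⟦Γ⟧`, `Γ = Lex (B →₀ ℚ)`, and the embedding `F[ℤ_M] ↪ F⟦Γ⟧` -/

section Hahn

variable {F : Type*} [Field F] {M : ℕ} [hM : Fact M.Prime]

/-- The index type of a `ℚ`-basis of `ℚ_M`. [folklore] -/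
def ExpIdx (M : ℕ) [Fact M.Prime] : Type := ↥(Module.Basis.ofVectorSpaceIndex ℚ ℚ_[M])

/-- A (well-)ordering of the basis index type. [folklore] -/
instance instLinearOrderExpIdx : LinearOrder (ExpIdx M) := by
  classical exact linearOrderOfSTO WellOrderingRel

/-- **The value group `Γ = Lex (B →₀ ℚ)`**, a linearly ordered abelian group into which the
additive group of `ℤ_M` embeds (Sinnott orders the monomials in `X₁,…,X_n`; we use a `ℚ`-basis of
`ℚ_M` instead of a `ℤ`-basis of `ℤ[V]`). [cite: Sinnott1987, Corollary 2.4 and Appendix] -/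
abbrev ExpGrp (M : ℕ) [Fact M.Prime] : Type := Lex (ExpIdx M →₀ ℚ)

/-- The coordinate embedding `ℤ_M →+ Γ`. [folklore] -/
def coords : ℤ_[M] →+ ExpGrp M where
  toFun x := toLex ((Module.Basis.ofVectorSpace ℚ ℚ_[M]).repr (x : ℚ_[M]))
  map_zero' := by simp only [PadicInt.coe_zero, map_zero]; rfl
  map_add' x y := by simp only [PadicInt.coe_add, map_add]; rfl

/-- `coords` is injective. [folklore] -/
theorem coords_injective : Function.Injective (coords (M := M)) := by
  intro x y h
  simp only [coords, AddMonoidHom.coe_mk, ZeroHom.coe_mk, toLex_inj] at h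
  exact Subtype.ext ((Module.Basis.ofVectorSpace ℚ ℚ_[M]).repr.injective h)

/-- `coords` of a nonzero element is nonzero. [folklore] -/
theorem coords_ne_zero {x : ℤ_[M]} (hx : x ≠ 0) : coords x ≠ 0 := fun h ↦
  hx (coords_injective (by rw [h, map_zero]))

/-- `η⁻¹` has nonzero coordinates. [folklore] -/
theorem coords_inv_ne_zero (η : ℤ_[M]ˣ) : coords ((η⁻¹ : ℤ_[M]ˣ) : ℤ_[M]) ≠ 0 :=
  coords_ne_zero (Units.ne_zero _)

/-- `coords ((-η)⁻¹) = - coords (η⁻¹)`. [folklore] -/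
theorem coords_neg_inv (η : ℤ_[M]ˣ) :
    coords (((-η)⁻¹ : ℤ_[M]ˣ) : ℤ_[M]) = -coords ((η⁻¹ : ℤ_[M]ˣ) : ℤ_[M]) := by
  rw [inv_neg, Units.val_neg, map_neg]

/-- `|coords (θ⁻¹)| > 0`, the exponent used for the Laurent expansion attached to `θ`. [folklore] -/
def yabs (θ : ℤ_[M]ˣ) : ExpGrp M :=
  max (coords ((θ⁻¹ : ℤ_[M]ˣ) : ℤ_[M])) (-coords ((θ⁻¹ : ℤ_[M]ˣ) : ℤ_[M]))

/-- `yabs θ > 0`. [folklore] -/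
theorem yabs_pos (θ : ℤ_[M]ˣ) : 0 < yabs θ := by
  unfold yabs
  rcases lt_trichotomy (coords ((θ⁻¹ : ℤ_[M]ˣ) : ℤ_[M])) 0 with h | h | h
  · exact lt_max_of_lt_right (neg_pos.mpr h)
  · exact absurd h (coords_inv_ne_zero θ)
  · exact lt_max_of_lt_left h

/-- **`V₊`**: the elements `θ ∈ V` with `coords(θ⁻¹) > 0`; `V = V₊ ⊔ (-V₊)` (Sinnott's
representatives `η₁,…,η_m` of `V/{±1}`). [cite: Sinnott1987, proof of Theorem 3.2] -/
def posTeich (M : ℕ) [Fact M.Prime] : Finset ℤ_[M]ˣ :=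
  (teich M).filter (fun θ ↦ 0 < coords ((θ⁻¹ : ℤ_[M]ˣ) : ℤ_[M]))

/-- Membership in `V₊`. [folklore] -/
theorem mem_posTeich_iff (θ : ℤ_[M]ˣ) :
    θ ∈ posTeich M ↔ θ ∈ teich M ∧ 0 < coords ((θ⁻¹ : ℤ_[M]ˣ) : ℤ_[M]) := mem_filter

/-- On `V₊`, `yabs θ = coords (θ⁻¹)`. [folklore] -/
theorem yabs_eq_of_mem_posTeich {θ : ℤ_[M]ˣ} (hθ : θ ∈ posTeich M) :
    yabs θ = coords ((θ⁻¹ : ℤ_[M]ˣ) : ℤ_[M]) := by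
  rw [mem_posTeich_iff] at hθ
  exact max_eq_left (le_of_lt (lt_trans (neg_neg_of_pos hθ.2) hθ.2))

/-- **`V = V₊ ⊔ (-V₊)`**: sums over `V` split. [cite: Sinnott1987, proof of Theorem 3.2] -/
theorem sum_teich_eq_sum_posTeich_add {β : Type*} [AddCommMonoid β] (h : ℤ_[M]ˣ → β) :
    ∑ η ∈ teich M, h η = ∑ θ ∈ posTeich M, h θ + ∑ θ ∈ posTeich M, h (-θ) := by
  rw [posTeich, ← Finset.sum_filter_add_sum_filter_not (teich M)
    (fun θ ↦ 0 < coords ((θ⁻¹ : ℤ_[M]ˣ) : ℤ_[M]))]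
  congr 1
  symm
  refine Finset.sum_nbij (fun θ ↦ -θ) (fun θ hθ ↦ ?_) (fun θ _ θ' _ hh ↦ neg_injective hh)
    (fun η hη ↦ ?_) (fun _ _ ↦ rfl)
  · rw [mem_filter] at hθ ⊢
    refine ⟨neg_mem_teich hθ.1, ?_⟩
    rw [coords_neg_inv, not_lt]
    exact le_of_lt (neg_neg_of_pos hθ.2)
  · rw [mem_coe, mem_filter, not_lt] at hη
    have hlt : coords ((η⁻¹ : ℤ_[M]ˣ) : ℤ_[M]) < 0 := lt_of_le_of_ne hη.2 (coords_inv_ne_zero η)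
    refine ⟨-η, ?_, neg_neg η⟩
    rw [mem_coe, mem_filter]
    exact ⟨neg_mem_teich hη.1, by rw [coords_neg_inv]; exact neg_pos.mpr hlt⟩

/-- The monomial map `a ↦ single (coords a) 1`, multiplicative. [cite: Sinnott1987, Corollary 2.4] -/
def expMonomial : Multiplicative ℤ_[M] →* HahnSeries (ExpGrp M) F where
  toFun a := HahnSeries.single (coords (Multiplicative.toAdd a)) (1 : F)
  map_one' := by rw [toAdd_one, map_zero]; rfl
  map_mul' a b := by rw [toAdd_mul, map_add, HahnSeries.single_mul_single, mul_one]

variable (F) in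
/-- **The embedding `F[ℤ_M] → F⟦Γ⟧`, `[a] ↦ single (coords a) 1`** (Sinnott's inclusion
`F(X₁,…,X_n) ↪ 𝒥₀` of Corollary 2.4, realised in a Hahn-series field). [cite: Sinnott1987,
Corollary 2.4] -/
def emb : AddMonoidAlgebra F ℤ_[M] →ₐ[F] HahnSeries (ExpGrp M) F :=
  AddMonoidAlgebra.lift F (HahnSeries (ExpGrp M) F) ℤ_[M] expMonomial

/-- `emb ∘ substInv η` is `aeval` at `single (coords η⁻¹) 1`. [folklore] -/
theorem emb_substInv (η : ℤ_[M]ˣ) (P : F[X]) :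
    emb F (substInv η P) =
      Polynomial.aeval (HahnSeries.single (coords ((η⁻¹ : ℤ_[M]ˣ) : ℤ_[M])) (1 : F)) P := by
  rw [substInv, ← Polynomial.aeval_algHom_apply]
  congr 1
  rw [emb, AddMonoidAlgebra.lift_single, one_smul]; rfl

/-- The Laurent expansion along `y > 0` of a polynomial is `aeval` at `single y 1`. [folklore] -/
theorem laurentAt_algebraMap {y : ExpGrp M} (hy : 0 < y) (P : F[X]) :
    laurentAt hy (algebraMap F[X] (RatFunc F) P) = Polynomial.aeval (HahnSeries.single y (1 : F)) P := by
  have : (laurentAt (F := F) hy).comp (algebraMap F[X] (RatFunc F)) =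
      (Polynomial.aeval (HahnSeries.single y (1 : F)) : F[X] →ₐ[F] HahnSeries (ExpGrp M) F).toRingHom := by
    refine Polynomial.ringHom_ext (fun c ↦ ?_) ?_
    · rw [RingHom.comp_apply, RatFunc.algebraMap_C, laurentAt_C, AlgHom.toRingHom_eq_coe,
        AlgHom.coe_toRingHom, Polynomial.aeval_C, ← HahnSeries.C_eq_algebraMap]
    · rw [RingHom.comp_apply, RatFunc.algebraMap_X, laurentAt_X, AlgHom.toRingHom_eq_coe,
        AlgHom.coe_toRingHom, Polynomial.aeval_X]
  exact RingHom.congr_fun this P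

/-- The Laurent expansion along `y > 0` of `P(Z⁻¹)` is `aeval` at `single (-y) 1`. [folklore] -/
theorem laurentAt_invX_algebraMap {y : ExpGrp M} (hy : 0 < y) (P : F[X]) :
    laurentAt hy (invX (algebraMap F[X] (RatFunc F) P)) =
      Polynomial.aeval (HahnSeries.single (-y) (1 : F)) P := by
  have : ((laurentAt (F := F) hy).comp (invX : RatFunc F →ₐ[F] RatFunc F).toRingHom).comp
        (algebraMap F[X] (RatFunc F)) =
      (Polynomial.aeval (HahnSeries.single (-y) (1 : F)) : F[X] →ₐ[F] HahnSeries (ExpGrp M) F).toRingHom := by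
    refine Polynomial.ringHom_ext (fun c ↦ ?_) ?_
    · rw [RingHom.comp_apply, RingHom.comp_apply, RatFunc.algebraMap_C, AlgHom.toRingHom_eq_coe,
        AlgHom.coe_toRingHom, algHom_C, laurentAt_C, AlgHom.toRingHom_eq_coe, AlgHom.coe_toRingHom,
        Polynomial.aeval_C, ← HahnSeries.C_eq_algebraMap]
    · rw [RingHom.comp_apply, RingHom.comp_apply, RatFunc.algebraMap_X, AlgHom.toRingHom_eq_coe,
        AlgHom.coe_toRingHom, invX_X, map_inv₀, laurentAt_X, HahnSeries.inv_single, inv_one,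
        AlgHom.toRingHom_eq_coe, AlgHom.coe_toRingHom, Polynomial.aeval_X]
  exact RingHom.congr_fun this P

omit hM in
/-- `g(ε^j X) ≠ 0`. [folklore] -/
theorem denPoly_ne_zero {n₀ : ℕ} {ε₁ : F} (hε : ε₁ ≠ 0) {g : F[X]} (hg : g ≠ 0) (j : ZMod (M ^ n₀)) :
    denPoly n₀ ε₁ g j ≠ 0 := by
  rw [denPoly, Ne, Polynomial.comp_eq_zero_iff, not_or]
  refine ⟨hg, fun ⟨_, h⟩ ↦ ?_⟩
  have h1 := congrArg (fun q : F[X] ↦ q.coeff 1) h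
  simp only [coeff_C_mul, coeff_X_one, mul_one, coeff_C, one_ne_zero, if_false] at h1
  exact pow_ne_zero _ hε h1

/-- The rational function `R_a = ∑_j numPoly_j / denPoly_j ∈ F(Z)` (Sinnott's `R_{η,y}` with
`a = η y mod M^{n₀}`). [cite: Sinnott1987, proof of Theorem 3.2] -/
def rfrac (n₀ : ℕ) (ε₁ : F) (f g : F[X]) (a : ZMod (M ^ n₀)) : RatFunc F :=
  ∑ j : ZMod (M ^ n₀), algebraMap F[X] (RatFunc F) (numPoly n₀ ε₁ f a j) /
    algebraMap F[X] (RatFunc F) (denPoly n₀ ε₁ g j)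

/-- `a(η, y) = η y mod M^{n₀}`. [folklore] -/
abbrev aIdx (n₀ : ℕ) (η y : ℤ_[M]ˣ) : ZMod (M ^ n₀) := PadicInt.toZModPow n₀ ((η * y : ℤ_[M]ˣ) : ℤ_[M])

/-- **`P_y = 0` forces `R_{θ,y}(Z) + R_{-θ,y}(Z⁻¹) ∈ F` for every `θ ∈ V₊`** (Sinnott's (3.13),
via Corollary 2.4 and the Appendix). [cite: Sinnott1987, proof of Theorem 3.2, (3.13)] -/
theorem exists_C_of_Pelem_eq_zero {n₀ : ℕ} {ε₁ : F} (hε : ε₁ ≠ 0) (f : F[X]) {g : F[X]}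
    (hg : g ≠ 0) (y : ℤ_[M]ˣ) (h : Pelem n₀ ε₁ f g y = 0) :
    ∀ θ ∈ posTeich M, ∃ c : F,
      rfrac n₀ ε₁ f g (aIdx n₀ θ y) + invX (rfrac n₀ ε₁ f g (aIdx n₀ (-θ) y)) = RatFunc.C c := by
  classical
  set K := HahnSeries (ExpGrp M) F
  set χ : AddMonoidAlgebra F ℤ_[M] →+* K := (emb F (M := M)).toRingHom with hχ
  have hχ' : ∀ P, emb F (M := M) P = χ P := fun P ↦ rfl
  -- the two ways of writing `emb (substInv η P)` as a Laurent expansion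
  have hpos : ∀ θ ∈ posTeich M, ∀ P : F[X],
      χ (substInv θ P) = laurentAt (yabs_pos θ) (algebraMap F[X] (RatFunc F) P) := by
    intro θ hθ P
    rw [← hχ', emb_substInv, laurentAt_algebraMap, yabs_eq_of_mem_posTeich hθ]
  have hneg : ∀ θ ∈ posTeich M, ∀ P : F[X],
      χ (substInv (-θ) P) = laurentAt (yabs_pos θ) (invX (algebraMap F[X] (RatFunc F) P)) := by
    intro θ hθ P
    rw [← hχ', emb_substInv, laurentAt_invX_algebraMap, yabs_eq_of_mem_posTeich hθ, coords_neg_inv]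
  -- denominators do not vanish in `K`
  have hden : ∀ ij ∈ idx M n₀, χ (substInv ij.1 (denPoly n₀ ε₁ g ij.2)) ≠ 0 := by
    rintro ⟨η, j⟩ hij
    rw [idx, mem_product] at hij
    have hη : η ∈ teich M := hij.1
    have hne : algebraMap F[X] (RatFunc F) (denPoly n₀ ε₁ g j) ≠ 0 :=
      (map_ne_zero_iff _ (IsFractionRing.injective F[X] (RatFunc F))).mpr (denPoly_ne_zero hε hg j)
    by_cases hsgn : 0 < coords ((η⁻¹ : ℤ_[M]ˣ) : ℤ_[M])
    · have hθ : η ∈ posTeich M := (mem_posTeich_iff η).mpr ⟨hη, hsgn⟩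
      rw [hpos η hθ]
      exact (map_ne_zero_iff _ (laurentAt (F := F) (yabs_pos η)).injective).mpr hne
    · have hlt : coords ((η⁻¹ : ℤ_[M]ˣ) : ℤ_[M]) < 0 :=
        lt_of_le_of_ne (not_lt.mp hsgn) (coords_inv_ne_zero η)
      have hθ : -η ∈ posTeich M :=
        (mem_posTeich_iff _).mpr ⟨neg_mem_teich hη, by rw [coords_neg_inv]; exact neg_pos.mpr hlt⟩
      have := hneg (-η) hθ (denPoly n₀ ε₁ g j)
      rw [neg_neg] at this
      rw [this]
      exact (map_ne_zero_iff _ (laurentAt (F := F) (yabs_pos (-η))).injective).mpr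
        ((map_ne_zero_iff _ (invX : RatFunc F →ₐ[F] RatFunc F).toRingHom.injective).mpr hne)
  -- `emb (P_y) = 0` and clearing denominators
  have h0 : χ (Pelem n₀ ε₁ f g y) = 0 := by rw [h, map_zero]
  unfold Pelem at h0
  rw [map_clearedSum χ _ _ _ hden, mul_eq_zero] at h0
  have hsum : ∑ ij ∈ idx M n₀,
      χ (substInv ij.1 (numPoly n₀ ε₁ f (aIdx n₀ ij.1 y) ij.2)) /
        χ (substInv ij.1 (denPoly n₀ ε₁ g ij.2)) = 0 := by
    rcases h0 with h0 | h0
    · exact h0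
    · exact absurd h0 (prod_ne_zero_iff.mpr hden)
  -- regroup: `∑_{θ ∈ V₊} laurentAt_θ (u_θ) = 0`
  set u : ℤ_[M]ˣ → RatFunc F := fun θ ↦
    rfrac n₀ ε₁ f g (aIdx n₀ θ y) + invX (rfrac n₀ ε₁ f g (aIdx n₀ (-θ) y)) with hu
  have hsum' : ∑ θ ∈ posTeich M, laurentAt (yabs_pos θ) (u θ) = 0 := by
    rw [← hsum, idx, sum_product, sum_teich_eq_sum_posTeich_add, ← sum_add_distrib]
    refine sum_congr rfl fun θ hθ ↦ ?_
    simp only [hu, map_add, rfrac, map_sum, map_div₀, hpos θ hθ, hneg θ hθ]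
  -- Sinnott's Appendix
  have hind : ∀ i ∈ posTeich M, ∀ j ∈ posTeich M, ∀ a b : ℤ, a ≠ 0 → a • yabs i = b • yabs j → i = j := by
    intro i hi j hj a b ha hab
    rw [yabs_eq_of_mem_posTeich hi, yabs_eq_of_mem_posTeich hj, ← map_zsmul, ← map_zsmul] at hab
    have hab' := coords_injective hab
    rw [zsmul_eq_mul, zsmul_eq_mul] at hab'
    rcases eq_or_eq_neg_of_zsmul_inv_eq ((mem_posTeich_iff i).mp hi).1 ((mem_posTeich_iff j).mp hj).1
      ha hab' with hij | hij
    · exact hij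
    · exfalso
      have h1 := ((mem_posTeich_iff i).mp hi).2
      rw [hij, coords_neg_inv] at h1
      exact absurd (neg_pos.mp h1) (not_lt.mpr (le_of_lt ((mem_posTeich_iff j).mp hj).2))
  exact isConstant_of_sum_ringHom_eq_zero (posTeich M) (fun θ _ ↦ yabs_pos θ) hind
    (fun θ ↦ laurentAt (yabs_pos θ)) (fun θ _ c ↦ laurentAt_C _ c) (fun θ _ ↦ laurentAt_X _) u hsum'

end Hahn


/-! ### Summing over `y ∈ U/(1 + M^{n₀}ℤ_M)` and `η ∈ V`: `∑ R_{η,y} = r` -/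

section Endgame

variable {F : Type*} [Field F] {M : ℕ} [hM : Fact M.Prime]

/-- `R_a = M^{-n₀} ∑_j ε^{-ja} σ_{ε^j}(r)`. [cite: Sinnott1987, proof of Theorem 3.2] -/
theorem rfrac_eq_sum_scaleX {n₀ : ℕ} (ε₁ : Fˣ) (f g : F[X]) (a : ZMod (M ^ n₀)) :
    rfrac n₀ (ε₁ : F) f g a = ∑ j : ZMod (M ^ n₀),
      RatFunc.C ((((M ^ n₀ : ℕ) : F))⁻¹ * pw (ε₁ : F) (-(j * a))) *
        scaleX (ε₁ ^ j.val) (algebraMap F[X] (RatFunc F) f / algebraMap F[X] (RatFunc F) g) := by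
  unfold rfrac
  refine sum_congr rfl fun j _ ↦ ?_
  rw [scaleX_div, numPoly, denPoly, map_mul, RatFunc.algebraMap_C, mul_div_assoc, Units.val_pow_eq_pow_val,
    ← pw_def]

/-- **Ramanujan sum**: `∑_{u ∈ (ℤ/M^{n₀})ˣ} ε^{u t} = M^{n₀}[t = 0] - M^{n₀-1}[M t = 0]` for a primitive
`M^{n₀}`-th root of unity `ε` (`n₀ ≥ 1`). [folklore] -/
theorem sum_units_pw_mul {n₀ : ℕ} (hn : 1 ≤ n₀) {ε : F} (hε : IsPrimitiveRoot ε (M ^ n₀))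
    (t : ZMod (M ^ n₀)) :
    ∑ u : (ZMod (M ^ n₀))ˣ, pw ε ((u : ZMod (M ^ n₀)) * t) =
      (if t = 0 then ((M ^ n₀ : ℕ) : F) else 0) -
        (if (M : ZMod (M ^ n₀)) * t = 0 then ((M ^ (n₀ - 1) : ℕ) : F) else 0) := by
  classical
  have hall : ∑ c : ZMod (M ^ n₀), pw ε (c * t) = if t = 0 then ((M ^ n₀ : ℕ) : F) else 0 :=
    sum_pw_mul hε t
  have hsplit := Finset.sum_filter_add_sum_filter_not (univ : Finset (ZMod (M ^ n₀)))
    (fun c ↦ IsUnit c) (fun c ↦ pw ε (c * t))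
  have hunits : ∑ c ∈ univ.filter (fun c : ZMod (M ^ n₀) ↦ IsUnit c), pw ε (c * t) =
      ∑ u : (ZMod (M ^ n₀))ˣ, pw ε ((u : ZMod (M ^ n₀)) * t) := by
    symm
    refine Finset.sum_nbij (fun u : (ZMod (M ^ n₀))ˣ ↦ (u : ZMod (M ^ n₀))) (fun u _ ↦ ?_) ?_
      (fun c hc ↦ ?_) (fun _ _ ↦ rfl)
    · exact mem_filter.mpr ⟨mem_univ _, Units.isUnit u⟩
    · exact fun u _ v _ h ↦ Units.ext h
    · rw [coe_filter] at hc
      obtain ⟨u, rfl⟩ := hc.2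
      exact ⟨u, by simp, rfl⟩
  have hpowM : M * M ^ (n₀ - 1) = M ^ n₀ := by rw [← pow_succ', Nat.sub_add_cancel hn]
  have hnon : ∑ c ∈ univ.filter (fun c : ZMod (M ^ n₀) ↦ ¬ IsUnit c), pw ε (c * t) =
      if (M : ZMod (M ^ n₀)) * t = 0 then ((M ^ (n₀ - 1) : ℕ) : F) else 0 := by
    have hset : univ.filter (fun c : ZMod (M ^ n₀) ↦ ¬ IsUnit c) =
        (range (M ^ (n₀ - 1))).image (fun i ↦ ((M * i : ℕ) : ZMod (M ^ n₀))) := by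
      ext c
      simp only [mem_filter, mem_univ, true_and, mem_image, mem_range]
      constructor
      · intro hc
        rw [← ZMod.natCast_zmod_val c, ZMod.isUnit_natCast_iff_not_dvd_pow hM.out (by omega),
          not_not] at hc
        obtain ⟨i, hi⟩ := hc
        refine ⟨i, ?_, ?_⟩
        · have h1 : M * i < M * M ^ (n₀ - 1) := by
            calc M * i = c.val := hi.symm
              _ < M ^ n₀ := ZMod.val_lt c
              _ = M * M ^ (n₀ - 1) := hpowM.symm
          exact Nat.lt_of_mul_lt_mul_left h1
        · rw [← hi, ZMod.natCast_zmod_val]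
      · rintro ⟨i, -, rfl⟩
        rw [ZMod.isUnit_natCast_iff_not_dvd_pow hM.out (by omega), not_not]
        exact dvd_mul_right M i
    have hinj : Set.InjOn (fun i ↦ ((M * i : ℕ) : ZMod (M ^ n₀))) (range (M ^ (n₀ - 1)) : Finset ℕ) := by
      intro i hi i' hi' h
      rw [mem_coe, mem_range] at hi hi'
      have hlt : ∀ k < M ^ (n₀ - 1), M * k < M ^ n₀ := fun k hk ↦ by
        calc M * k < M * M ^ (n₀ - 1) := Nat.mul_lt_mul_of_pos_left hk hM.out.pos
          _ = M ^ n₀ := hpowM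
      simp only at h
      rw [ZMod.natCast_eq_natCast_iff', Nat.mod_eq_of_lt (hlt i hi), Nat.mod_eq_of_lt (hlt i' hi')] at h
      exact Nat.eq_of_mul_eq_mul_left hM.out.pos h
    rw [hset, sum_image hinj]
    have hω : pw ε ((M : ZMod (M ^ n₀)) * t) ^ M ^ (n₀ - 1) = 1 := by
      rw [← pw_mul_natCast hε.pow_eq_one]
      have h0 : (M : ZMod (M ^ n₀)) * ((M ^ (n₀ - 1) : ℕ) : ZMod (M ^ n₀)) = 0 := by
        rw [← Nat.cast_mul, hpowM, ZMod.natCast_self]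
      have : (M : ZMod (M ^ n₀)) * t * ((M ^ (n₀ - 1) : ℕ) : ZMod (M ^ n₀)) = 0 := by
        calc _ = (M : ZMod (M ^ n₀)) * ((M ^ (n₀ - 1) : ℕ) : ZMod (M ^ n₀)) * t := by ring
          _ = 0 := by rw [h0, zero_mul]
      rw [this, pw_zero]
    have hterm : ∀ i : ℕ, pw ε (((M * i : ℕ) : ZMod (M ^ n₀)) * t) =
        pw ε ((M : ZMod (M ^ n₀)) * t) ^ i := by
      intro i
      rw [← pw_mul_natCast hε.pow_eq_one]; congr 1; push_cast; ring
    simp_rw [hterm]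
    by_cases hc : (M : ZMod (M ^ n₀)) * t = 0
    · rw [if_pos hc, hc, pw_zero]; simp
    · rw [if_neg hc, sum_range_pow_eq_zero hω (fun h ↦ hc ((pw_eq_one_iff hε _).mp h))]
  rw [← hall, ← hsplit, hunits, hnon]; ring

/-- The `j` with `M j = 0` in `ℤ/M^{n₀}` are `M^{n₀-1} i`, `i < M`. [folklore] -/
theorem sum_filter_mul_eq_zero {β : Type*} [AddCommMonoid β] {n₀ : ℕ} (hn : 1 ≤ n₀)
    (G : ZMod (M ^ n₀) → β) :
    ∑ j ∈ univ.filter (fun j : ZMod (M ^ n₀) ↦ (M : ZMod (M ^ n₀)) * j = 0), G j =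
      ∑ i ∈ range M, G ((M ^ (n₀ - 1) * i : ℕ) : ZMod (M ^ n₀)) := by
  classical
  have hpowM : M * M ^ (n₀ - 1) = M ^ n₀ := by rw [← pow_succ', Nat.sub_add_cancel hn]
  have hpowM' : M ^ (n₀ - 1) * M = M ^ n₀ := by rw [mul_comm, hpowM]
  have hset : univ.filter (fun j : ZMod (M ^ n₀) ↦ (M : ZMod (M ^ n₀)) * j = 0) =
      (range M).image (fun i ↦ ((M ^ (n₀ - 1) * i : ℕ) : ZMod (M ^ n₀))) := by
    ext j
    simp only [mem_filter, mem_univ, true_and, mem_image, mem_range]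
    constructor
    · intro hj
      rw [← ZMod.natCast_zmod_val j, ← Nat.cast_mul, ZMod.natCast_eq_zero_iff] at hj
      have hj' : M * M ^ (n₀ - 1) ∣ M * j.val := by rw [hpowM]; exact hj
      obtain ⟨i, hi⟩ := Nat.dvd_of_mul_dvd_mul_left hM.out.pos hj'
      refine ⟨i, ?_, ?_⟩
      · have h1 : M ^ (n₀ - 1) * i < M ^ (n₀ - 1) * M := by
          calc M ^ (n₀ - 1) * i = j.val := hi.symm
            _ < M ^ n₀ := ZMod.val_lt j
            _ = M ^ (n₀ - 1) * M := hpowM'.symm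
        exact Nat.lt_of_mul_lt_mul_left h1
      · rw [← hi, ZMod.natCast_zmod_val]
    · rintro ⟨i, -, rfl⟩
      rw [← Nat.cast_mul, ← mul_assoc, hpowM, Nat.cast_mul, ZMod.natCast_self, zero_mul]
  have hinj : Set.InjOn (fun i ↦ ((M ^ (n₀ - 1) * i : ℕ) : ZMod (M ^ n₀))) (range M : Finset ℕ) := by
    intro i hi i' hi' h
    rw [mem_coe, mem_range] at hi hi'
    have hlt : ∀ k < M, M ^ (n₀ - 1) * k < M ^ n₀ := fun k hk ↦ by
      calc M ^ (n₀ - 1) * k < M ^ (n₀ - 1) * M := Nat.mul_lt_mul_of_pos_left hk (pow_pos hM.out.pos _)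
        _ = M ^ n₀ := hpowM'
    simp only at h
    rw [ZMod.natCast_eq_natCast_iff', Nat.mod_eq_of_lt (hlt i hi), Nat.mod_eq_of_lt (hlt i' hi')] at h
    exact Nat.eq_of_mul_eq_mul_left (pow_pos hM.out.pos _) h
  rw [hset, sum_image hinj]

/-- **`∑_{u ∈ (ℤ/M^{n₀})ˣ} R_u = r - M⁻¹ ∑_{i<M} r(ζ₁^i Z)`** with `ζ₁ = ε^{M^{n₀-1}}`.
[cite: Sinnott1987, proof of Theorem 3.2 ("summing over `j` and over … `y`")] -/
theorem sum_units_rfrac {n₀ : ℕ} (hn : 1 ≤ n₀) (hMF : (M : F) ≠ 0) (ε₁ : Fˣ)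
    (hε₁ : IsPrimitiveRoot (ε₁ : F) (M ^ n₀)) (f g : F[X]) :
    ∑ u : (ZMod (M ^ n₀))ˣ, rfrac n₀ (ε₁ : F) f g (u : ZMod (M ^ n₀)) =
      algebraMap F[X] (RatFunc F) f / algebraMap F[X] (RatFunc F) g -
        RatFunc.C ((M : F)⁻¹) * ∑ i ∈ range M, scaleX (ε₁ ^ (M ^ (n₀ - 1) * i))
          (algebraMap F[X] (RatFunc F) f / algebraMap F[X] (RatFunc F) g) := by
  classical
  set r := algebraMap F[X] (RatFunc F) f / algebraMap F[X] (RatFunc F) g with hr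
  have hNF : ((M ^ n₀ : ℕ) : F) ≠ 0 := by rw [Nat.cast_pow]; exact pow_ne_zero _ hMF
  simp_rw [rfrac_eq_sum_scaleX]
  rw [← hr, sum_comm]
  have hinner : ∀ j : ZMod (M ^ n₀),
      ∑ u : (ZMod (M ^ n₀))ˣ, RatFunc.C ((((M ^ n₀ : ℕ) : F))⁻¹ * pw (ε₁ : F) (-(j * (u : ZMod (M ^ n₀))))) *
          scaleX (ε₁ ^ j.val) r =
        (if j = 0 then scaleX (ε₁ ^ j.val) r else 0) -
          (if (M : ZMod (M ^ n₀)) * j = 0 then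
            RatFunc.C ((((M ^ n₀ : ℕ) : F))⁻¹ * ((M ^ (n₀ - 1) : ℕ) : F)) * scaleX (ε₁ ^ j.val) r else 0) := by
    intro j
    rw [← sum_mul, ← map_sum, ← mul_sum]
    have : ∀ u : (ZMod (M ^ n₀))ˣ, pw (ε₁ : F) (-(j * (u : ZMod (M ^ n₀)))) =
        pw (ε₁ : F) ((u : ZMod (M ^ n₀)) * (-j)) := fun u ↦ by congr 1; ring
    simp_rw [this]
    rw [sum_units_pw_mul hn hε₁ (-j)]
    simp only [neg_eq_zero, mul_neg]
    split_ifs <;>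
      simp only [sub_zero, zero_sub, mul_neg, map_neg, neg_mul, mul_zero, map_zero, zero_mul, mul_sub,
        map_sub, sub_mul, inv_mul_cancel₀ hNF, map_one, one_mul]
  simp_rw [hinner, sum_sub_distrib]
  refine congrArg₂ (· - ·) ?_ ?_
  · rw [Finset.sum_ite_eq' univ (0 : ZMod (M ^ n₀)), if_pos (mem_univ _), ZMod.val_zero, pow_zero,
      scaleX_one]
  · have hfilt : ∀ (P : ZMod (M ^ n₀) → Prop) (_ : DecidablePred P) (G : ZMod (M ^ n₀) → RatFunc F),
        (∑ j : ZMod (M ^ n₀), (if P j then G j else 0)) = ∑ j ∈ univ.filter P, G j :=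
      fun P _ G ↦ (Finset.sum_filter P G).symm
    have hpowM' : M ^ (n₀ - 1) * M = M ^ n₀ := by rw [← pow_succ, Nat.sub_add_cancel hn]
    have hcoef : (((M ^ n₀ : ℕ) : F))⁻¹ * ((M ^ (n₀ - 1) : ℕ) : F) = (M : F)⁻¹ := by
      have hA : ((M ^ (n₀ - 1) : ℕ) : F) ≠ 0 := by rw [Nat.cast_pow]; exact pow_ne_zero _ hMF
      have : ((M ^ n₀ : ℕ) : F) = ((M ^ (n₀ - 1) : ℕ) : F) * M := by rw [← hpowM', Nat.cast_mul]
      rw [this]; field_simp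
    rw [hfilt, sum_filter_mul_eq_zero hn, mul_sum]
    refine sum_congr rfl fun i hi ↦ ?_
    rw [mem_range] at hi
    rw [hcoef, ZMod.val_natCast, Nat.mod_eq_of_lt]
    calc M ^ (n₀ - 1) * i < M ^ (n₀ - 1) * M := Nat.mul_lt_mul_of_pos_left hi (pow_pos hM.out.pos _)
      _ = M ^ n₀ := hpowM'

/-- The representative `1 + M^{depth M} k` of `U/(1 + M^{n₀}ℤ_M)` as a natural number. [folklore] -/
def yrepNat (M k : ℕ) : ℕ := 1 + M * (M ^ (depth M - 1) * k)

/-- `1 + M^{depth M} k` is a unit of `ℤ_M`. [folklore] -/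
theorem isUnit_yrepNat (k : ℕ) : IsUnit ((yrepNat M k : ℕ) : ℤ_[M]) := by
  rw [PadicInt.isUnit_iff, PadicInt.norm_natCast_eq_one_iff, yrepNat]
  exact ((Nat.coprime_add_mul_left_left 1 M _).mpr (Nat.coprime_one_left M)).symm

/-- The representatives `y_k = 1 + M^{depth M} k ∈ ℤ_Mˣ` of `U/(1 + M^{n₀}ℤ_M)` (`k < M^{n₀ - depth M}`).
[cite: Sinnott1987, proof of Theorem 3.2 ("a complete set of representatives `y ∈ U`")] -/
def yrep (k : ℕ) : ℤ_[M]ˣ := (isUnit_yrepNat (M := M) k).unit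

/-- `y_k mod M^{n₀}` is the unit `1 + M^{depth M} k`. [folklore] -/
theorem redUnits_yrep (n₀ k : ℕ) : redUnits n₀ (yrep (M := M) k) = unitOneAdd n₀ (depth M) k := by
  ext
  rw [coe_redUnits, yrep, IsUnit.unit_spec, map_natCast, unitOneAdd, ZMod.coe_unitOfCoprime, yrepNat]

/-- **`(y, η) ↦ η y mod M^{n₀}` is a bijection `{y_k} × V → (ℤ/M^{n₀})ˣ`**: double sums over
`k < M^{n₀ - depth M}` and `η ∈ V` are sums over the units modulo `M^{n₀}`.
[cite: Sinnott1987, proof of Theorem 3.2 (`ℤ_pˣ = V × U`, `U/(1+p^{n₀}ℤ_p)`)] -/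
theorem sum_range_sum_teich_eq_sum_units {β : Type*} [AddCommMonoid β] {n₀ : ℕ}
    (hd : depth M ≤ n₀) (G : ZMod (M ^ n₀) → β) :
    ∑ k ∈ range (M ^ (n₀ - depth M)), ∑ η ∈ teich M, G (aIdx n₀ η (yrep k)) =
      ∑ u : (ZMod (M ^ n₀))ˣ, G (u : ZMod (M ^ n₀)) := by
  classical
  have h1 : ∀ k, ∑ η ∈ teich M, G (aIdx n₀ η (yrep k)) =
      ∑ v ∈ univ.filter (fun v : (ZMod (M ^ n₀))ˣ ↦ IsTors v),
        G ((v * unitOneAdd n₀ (depth M) k : (ZMod (M ^ n₀))ˣ) : ZMod (M ^ n₀)) := by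
    intro k
    rw [sum_filter_isTors_eq_sum_teich hd]
    refine sum_congr rfl fun η _ ↦ ?_
    simp only [aIdx]
    rw [Units.val_mul, map_mul, ← coe_redUnits, ← coe_redUnits, redUnits_yrep, ← Units.val_mul]
  simp_rw [h1]
  rw [sum_comm, ← sum_filter_isTors_pow_eq (one_le_depth M) le_rfl hd (fun u ↦ G (u : ZMod (M ^ n₀))),
    Finset.filter_true_of_mem (fun u _ ↦ isTors_pow_pow_sub_depth hd u)]

/-- `∑_{i<M} h((ζ^i)⁻¹) = ∑_{i<M} h(ζ^i)` for `ζ^M = 1`. [folklore] -/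
theorem sum_range_inv_pow_eq {β : Type*} [AddCommMonoid β] {G : Type*} [CommGroup G] {ζ : G}
    (hζ : ζ ^ M = 1) (h : G → β) :
    ∑ i ∈ range M, h ((ζ ^ i)⁻¹) = ∑ i ∈ range M, h (ζ ^ i) := by
  have hM1 := hM.out.one_lt
  refine Finset.sum_nbij' (fun i ↦ if i = 0 then 0 else M - i) (fun i ↦ if i = 0 then 0 else M - i)
    (fun i hi ↦ ?_) (fun i hi ↦ ?_) (fun i hi ↦ ?_) (fun i hi ↦ ?_) (fun i hi ↦ ?_)
  · rw [mem_range] at hi ⊢; split_ifs <;> omega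
  · rw [mem_range] at hi ⊢; split_ifs <;> omega
  · rw [mem_range] at hi; split_ifs with h1 h2 <;> omega
  · rw [mem_range] at hi; split_ifs with h1 h2 <;> omega
  · rw [mem_range] at hi
    split_ifs with h0
    · rw [h0, pow_zero, inv_one]
    · congr 1
      refine inv_eq_of_mul_eq_one_right ?_
      rw [← pow_add, Nat.add_sub_cancel' hi.le, hζ]

/-- **Some `P_y ≠ 0`** (`y = 1 + M^{depth M} k`, `k < M^{n₀ - depth M}`): otherwise
`R_{θ,y}(Z) + R_{-θ,y}(Z⁻¹) ∈ F` for all `θ, y`, and summing gives `r(Z) + r(Z⁻¹) ∈ F`, hence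
`= 0` by the support condition `∑_{i<M} r(ζ₁^i Z) = 0` — contradicting `r(Z) + r(Z⁻¹) ≠ 0`.
[cite: Sinnott1987, proof of Theorem 3.2, (3.13)–(3.14) and (1.18)] -/
theorem exists_Pelem_ne_zero {p : ℕ} [hp : Fact p.Prime] [CharP F p] (hMp : M ≠ p) {n₀ : ℕ}
    (hn : 1 ≤ n₀) (hd : depth M ≤ n₀) (ε₁ : Fˣ) (hε₁ : IsPrimitiveRoot (ε₁ : F) (M ^ n₀))
    (f : F[X]) {g : F[X]} (hg : g ≠ 0)
    (hsupp : ∑ i ∈ range M, scaleX (ε₁ ^ (M ^ (n₀ - 1) * i))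
      (algebraMap F[X] (RatFunc F) f / algebraMap F[X] (RatFunc F) g) = 0)
    (hN : algebraMap F[X] (RatFunc F) f / algebraMap F[X] (RatFunc F) g +
      invX (algebraMap F[X] (RatFunc F) f / algebraMap F[X] (RatFunc F) g) ≠ 0) :
    ∃ k, k < M ^ (n₀ - depth M) ∧ Pelem n₀ (ε₁ : F) f g (yrep (M := M) k) ≠ 0 := by
  classical
  by_contra hall
  simp only [not_exists, not_and, not_not] at hall
  set r := algebraMap F[X] (RatFunc F) f / algebraMap F[X] (RatFunc F) g with hr
  have hMF : (M : F) ≠ 0 := fun h ↦ hMp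
    ((Nat.prime_dvd_prime_iff_eq hp.out hM.out).mp ((CharP.cast_eq_zero_iff F p M).mp h)).symm
  have hε0 : (ε₁ : F) ≠ 0 := ε₁.ne_zero
  -- the constants `c k θ`
  have hconst : ∀ k, k < M ^ (n₀ - depth M) → ∀ θ ∈ posTeich M, ∃ c : F,
      rfrac n₀ (ε₁ : F) f g (aIdx n₀ θ (yrep k)) +
        invX (rfrac n₀ (ε₁ : F) f g (aIdx n₀ (-θ) (yrep k))) = RatFunc.C c :=
    fun k hk ↦ exists_C_of_Pelem_eq_zero hε0 f hg (yrep (M := M) k) (hall k hk)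
  choose! c hc using hconst
  set S : ℕ → RatFunc F := fun k ↦ ∑ η ∈ teich M, rfrac n₀ (ε₁ : F) f g (aIdx n₀ η (yrep k)) with hS
  -- `S_k + ι S_k` is a constant
  have hSk : ∀ k, k < M ^ (n₀ - depth M) →
      S k + invX (S k) = RatFunc.C (∑ θ ∈ posTeich M, (c k θ + c k θ)) := by
    intro k hk
    have h1 : ∀ θ ∈ posTeich M,
        (rfrac n₀ (ε₁ : F) f g (aIdx n₀ θ (yrep k)) + rfrac n₀ (ε₁ : F) f g (aIdx n₀ (-θ) (yrep k))) +
          (invX (rfrac n₀ (ε₁ : F) f g (aIdx n₀ θ (yrep k))) +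
            invX (rfrac n₀ (ε₁ : F) f g (aIdx n₀ (-θ) (yrep k)))) = RatFunc.C (c k θ + c k θ) := by
      intro θ hθ
      have h2 := hc k hk θ hθ
      have h3 := congrArg invX h2
      rw [map_add, invX_invX, algHom_C] at h3
      rw [map_add (RatFunc.C)]
      nth_rewrite 1 [← h2]
      rw [← h3]
      abel
    calc S k + invX (S k)
        = ∑ θ ∈ posTeich M,
            ((rfrac n₀ (ε₁ : F) f g (aIdx n₀ θ (yrep k)) + rfrac n₀ (ε₁ : F) f g (aIdx n₀ (-θ) (yrep k))) +
              (invX (rfrac n₀ (ε₁ : F) f g (aIdx n₀ θ (yrep k))) +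
                invX (rfrac n₀ (ε₁ : F) f g (aIdx n₀ (-θ) (yrep k))))) := by
          simp only [hS]
          rw [sum_teich_eq_sum_posTeich_add (fun η ↦ rfrac n₀ (ε₁ : F) f g (aIdx n₀ η (yrep k))),
            map_add, map_sum, map_sum, ← sum_add_distrib, ← sum_add_distrib, ← sum_add_distrib]
      _ = ∑ θ ∈ posTeich M, RatFunc.C (c k θ + c k θ) := sum_congr rfl h1
      _ = RatFunc.C (∑ θ ∈ posTeich M, (c k θ + c k θ)) := (map_sum _ _ _).symm
  -- `∑_k S_k = r`
  have hsum : ∑ k ∈ range (M ^ (n₀ - depth M)), S k = r := by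
    simp only [hS]
    rw [sum_range_sum_teich_eq_sum_units hd (fun a ↦ rfrac n₀ (ε₁ : F) f g a),
      sum_units_rfrac hn hMF ε₁ hε₁ f g, ← hr, hsupp, mul_zero, sub_zero]
  set κ : F := ∑ k ∈ range (M ^ (n₀ - depth M)), ∑ θ ∈ posTeich M, (c k θ + c k θ) with hκdef
  have hκ : r + invX r = RatFunc.C κ := by
    rw [← hsum, map_sum, ← sum_add_distrib, hκdef, map_sum]
    exact sum_congr rfl fun k hk ↦ hSk k (mem_range.mp hk)
  -- apply `T = ∑_{i<M} σ_{ζ₁^i}`, `ζ₁ = ε₁^{M^{n₀-1}}`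
  set ζ₁ : Fˣ := ε₁ ^ M ^ (n₀ - 1) with hζ₁
  have hζM : ζ₁ ^ M = 1 := by
    rw [hζ₁, ← pow_mul, ← pow_succ, Nat.sub_add_cancel hn]
    ext; rw [Units.val_pow_eq_pow_val, hε₁.pow_eq_one, Units.val_one]
  have hTdef : ∀ x : RatFunc F, ∑ i ∈ range M, scaleX (ε₁ ^ (M ^ (n₀ - 1) * i)) x =
      ∑ i ∈ range M, scaleX (ζ₁ ^ i) x := fun x ↦ by simp_rw [pow_mul, hζ₁]
  have hTr : ∑ i ∈ range M, scaleX (ζ₁ ^ i) r = 0 := by rw [← hTdef, hsupp]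
  have hTι : ∑ i ∈ range M, scaleX (ζ₁ ^ i) (invX r) = 0 := by
    simp_rw [scaleX_invX]
    rw [← map_sum, sum_range_inv_pow_eq hζM (fun c ↦ scaleX c r), hTr, map_zero]
  have hTC : ∑ i ∈ range M, scaleX (ζ₁ ^ i) (RatFunc.C κ) = RatFunc.C ((M : F) * κ) := by
    simp_rw [algHom_C]
    rw [sum_const, card_range, nsmul_eq_mul, map_mul, map_natCast]
  have hfin : RatFunc.C ((M : F) * κ) = 0 := by
    rw [← hTC, ← hκ]
    simp_rw [map_add]
    rw [sum_add_distrib, hTr, hTι, add_zero]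
  have hκ0 : κ = 0 := by
    rw [map_eq_zero_iff _ (RatFunc.C (K := F)).injective, mul_eq_zero] at hfin
    exact hfin.resolve_left hMF
  rw [hκ0, map_zero] at hκ
  exact hN hκ

end Endgame

/-! ### Theorem 3.2 and its corollary for `∑_c ψ(c) φ(ζ^c)` -/

section Main

variable {F E : Type*} [Field F] [Field E] [Algebra F E] {M : ℕ} [hM : Fact M.Prime]
  {p : ℕ} [hp : Fact p.Prime] [CharP E p]

/-- **Sinnott's Theorem 3.2 (finite, effective form).**  Let `F ⊆ E` be fields of characteristic
`p`, `q = p^d` with `c^q = c` on `F`, `M ≠ p` prime with `M ∣ q - 1` (`4 ∣ q - 1` if `M = 2`) and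
`M^{n₀} ∥ q - 1`, `ε₁ ∈ F` a primitive `M^{n₀}`-th root of unity, and `r = f/g ∈ F(Z)` (`g ≠ 0`)
with `∑_{i<M} r(ζ₁^i Z) = 0` (`ζ₁ = ε₁^{M^{n₀-1}}`; the measure is supported on `ℤ_Mˣ`) and
`r(Z) + r(Z⁻¹) ≠ 0`.  Then for all large `m`, every primitive `M^m`-th root of unity `ζ ∈ E`
and every character `ψ : (ℤ/M^m)ˣ → Eˣ` with kernel exactly `V`:  `Γ_α(ψ) ≠ 0`, where `α`
is the level-`M^m` measure of `φ = f/g` on `μ_{M^m}`.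
[cite: Sinnott1987, Theorem 3.2] -/
theorem sinnott_gammaTransform_ne_zero (hMp : M ≠ p) {q d : ℕ} (hqd : q = p ^ d)
    (hq : GoodModulus M q) (hF : ∀ c : F, c ^ q = c) {n₀ : ℕ} (hn₀ : padicValNat M (q - 1) = n₀)
    (ε₁ : Fˣ) (hε₁ : IsPrimitiveRoot (ε₁ : F) (M ^ n₀)) (f : F[X]) {g : F[X]} (hg : g ≠ 0)
    (hsupp : ∑ i ∈ range M, scaleX (ε₁ ^ (M ^ (n₀ - 1) * i))
      (algebraMap F[X] (RatFunc F) f / algebraMap F[X] (RatFunc F) g) = 0)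
    (hN : algebraMap F[X] (RatFunc F) f / algebraMap F[X] (RatFunc F) g +
      invX (algebraMap F[X] (RatFunc F) f / algebraMap F[X] (RatFunc F) g) ≠ 0) :
    ∃ m₀, ∀ m, m₀ ≤ m → ∀ ζ : E, IsPrimitiveRoot ζ (M ^ m) → ∀ ψ : (ZMod (M ^ m))ˣ →* Eˣ,
      (∀ v, IsTors v → ψ v = 1) → (∀ u, ψ u = 1 → IsTors u) →
        gammaTransform ζ (ratFn f g : E → E) ψ ≠ 0 := by
  haveI : CharP F p := (algebraMap F E).charP (algebraMap F E).injective p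
  have hn : 1 ≤ n₀ := hn₀ ▸ hq.one_le_padicValNat
  have hd : depth M ≤ n₀ := depth_le_of_goodModulus hq hn₀
  obtain ⟨k, -, hk⟩ := exists_Pelem_ne_zero hMp hn hd ε₁ hε₁ f hg hsupp hN
  exact exists_level_gammaTransform_ne_zero_of_Pelem_ne_zero hMp hqd hq hF hn₀ hε₁ hg hk

omit hp [CharP E p] in
/-- The unit `g = 1 + M^{m-1}` witnesses the primitivity of a character with kernel `V`
(`depth M + 1 ≤ m`): `c g = c` for non-units `c` and `ψ(g) ≠ 1`. [cite: Sinnott1987, (1.15)] -/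
theorem primitivity_witness {m : ℕ} (hm : depth M + 1 ≤ m) {ψ : (ZMod (M ^ m))ˣ →* Eˣ}
    (hK2 : ∀ u, ψ u = 1 → IsTors u) :
    (∀ c : ZMod (M ^ m), ¬ IsUnit c → c * (unitOneAdd m (m - 1) 1 : (ZMod (M ^ m))ˣ) = c) ∧
      ψ (unitOneAdd m (m - 1) 1) ≠ 1 := by
  have hd1 := one_le_depth M
  have hm1 : 1 ≤ m - 1 := by omega
  constructor
  · intro c hc
    rw [← ZMod.natCast_zmod_val c, ZMod.isUnit_natCast_iff_not_dvd_pow hM.out (by omega), not_not] at hc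
    obtain ⟨t, ht⟩ := hc
    have hc' : c = ((M * t : ℕ) : ZMod (M ^ m)) := by rw [← ht, ZMod.natCast_zmod_val]
    rw [hc', unitOneAdd, ZMod.coe_unitOfCoprime, mul_one]
    push_cast
    have hz : (M : ZMod (M ^ m)) * ((M : ZMod (M ^ m)) * (M : ZMod (M ^ m)) ^ (m - 1 - 1)) = 0 := by
      rw [← pow_succ', ← pow_succ', Nat.sub_add_cancel hm1, Nat.sub_add_cancel (by omega : 1 ≤ m),
        ← Nat.cast_pow, ZMod.natCast_self]
    linear_combination (t : ZMod (M ^ m)) * hz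
  · intro h1
    have htors := hK2 _ h1
    have hcong : CongOne (depth M) ((unitOneAdd m (m - 1) 1 : (ZMod (M ^ m))ˣ) : ZMod (M ^ m)) :=
      (congOne_unitOneAdd hm1 (by omega) (by
        rw [Nat.sub_sub_self (by omega : 1 ≤ m), pow_one]; exact hM.out.one_lt)).mono (by omega)
    have h := eq_one_of_isTors_of_congOne (by omega) htors hcong
    have hval := val_unitOneAdd (m := m) hm1 (by omega)
      (show 1 < M ^ (m - (m - 1)) by rw [Nat.sub_sub_self (by omega : 1 ≤ m), pow_one]; exact hM.out.one_lt)
    rw [h, Units.val_one] at hval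
    have : Fact (1 < M ^ m) := ⟨Nat.one_lt_pow (by omega) hM.out.one_lt⟩
    rw [ZMod.val_one] at hval
    have := pow_pos hM.out.pos (m - 1)
    omega

/-- **Corollary (the form used for Washington's theorem).**  Under the hypotheses of
`sinnott_gammaTransform_ne_zero`, for all large `m`, all primitive `M^m`-th roots of unity `ζ ∈ E`
and all characters `ψ` of `(ℤ/M^m)ˣ` with kernel exactly `V`:
`∑_{c ∈ (ℤ/M^m)ˣ} ψ(c) f(ζ^c)/g(ζ^c) ≠ 0`. [cite: Sinnott1987, Theorem 3.2 with (1.15)] -/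
theorem sinnott_sum_psi_ratFn_ne_zero (hMp : M ≠ p) {q d : ℕ} (hqd : q = p ^ d)
    (hq : GoodModulus M q) (hF : ∀ c : F, c ^ q = c) {n₀ : ℕ} (hn₀ : padicValNat M (q - 1) = n₀)
    (ε₁ : Fˣ) (hε₁ : IsPrimitiveRoot (ε₁ : F) (M ^ n₀)) (f : F[X]) {g : F[X]} (hg : g ≠ 0)
    (hsupp : ∑ i ∈ range M, scaleX (ε₁ ^ (M ^ (n₀ - 1) * i))
      (algebraMap F[X] (RatFunc F) f / algebraMap F[X] (RatFunc F) g) = 0)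
    (hN : algebraMap F[X] (RatFunc F) f / algebraMap F[X] (RatFunc F) g +
      invX (algebraMap F[X] (RatFunc F) f / algebraMap F[X] (RatFunc F) g) ≠ 0) :
    ∃ m₀, ∀ m, m₀ ≤ m → ∀ ζ : E, IsPrimitiveRoot ζ (M ^ m) → ∀ ψ : (ZMod (M ^ m))ˣ →* Eˣ,
      (∀ v, IsTors v → ψ v = 1) → (∀ u, ψ u = 1 → IsTors u) →
        ∑ c : (ZMod (M ^ m))ˣ, (ψ c : E) * ratFn f g (pw ζ (c : ZMod (M ^ m))) ≠ 0 := by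
  obtain ⟨m₀, hm₀⟩ := sinnott_gammaTransform_ne_zero (E := E) hMp hqd hq hF hn₀ ε₁ hε₁ f hg hsupp hN
  refine ⟨max m₀ (depth M + 1), fun m hm ζ hζ ψ hK1 hK2 hsum ↦ ?_⟩
  have hm₀' : m₀ ≤ m := le_trans (le_max_left _ _) hm
  have hmd : depth M + 1 ≤ m := le_trans (le_max_right _ _) hm
  -- apply the theorem to `ψ⁻¹`
  have hK1' : ∀ v, IsTors v → ψ⁻¹ v = 1 := fun v hv ↦ by rw [MonoidHom.inv_apply, hK1 v hv, inv_one]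
  have hK2' : ∀ u, ψ⁻¹ u = 1 → IsTors u := fun u hu ↦ hK2 u (by rwa [MonoidHom.inv_apply, inv_eq_one] at hu)
  obtain ⟨hg', hψg⟩ := primitivity_witness (E := E) hmd hK2'
  have hΓ := gammaTransform_eq_mul_sum (ζ := ζ) (ratFn f g : E → E) ψ⁻¹ hg' hψg
  have hzero : gammaTransform ζ (ratFn f g : E → E) ψ⁻¹ = 0 := by
    rw [hΓ]
    have : ∑ c : (ZMod (M ^ m))ˣ, (((ψ⁻¹ c)⁻¹ : Eˣ) : E) * ratFn f g (pw ζ (c : ZMod (M ^ m))) = 0 := by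
      simp_rw [MonoidHom.inv_apply, inv_inv]; exact hsum
    rw [this, mul_zero]
  exact hm₀ m hm₀' ζ hζ ψ⁻¹ hK1' hK2' hzero

end Main

end Literature.NumberTheory.LFunctions.Sinnott1987
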